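import Literature.AlgebraicGeometry.Resolution.SpreadModelDataRestrict
import Literature.AlgebraicGeometry.Resolution.SpreadIdealSheafInclusion
import Literature.AlgebraicGeometry.Resolution.BoundaryEquivalence
import HarnessLib

/-!
# Model data over a basic open of the base: spreading out from the generic fibre

Topic: `Literature/AlgebraicGeometry/Resolution`. The MODEL half of the spreading-out argument
for `SpreadsShapedFromGenericPoint` (`CanonicalResolutionSpread.lean`; EGA IV₃ §8–§9
technique). Setting: `A` a Noetherian domain with fraction field `K` of characteristic zero,
`q : X → Spec A` of finite type, `jK : X_K → X` its generic fibre (any cartesian square), `s` a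
multiple blow-up of `X` (`CentreSeq`), `𝓘` an ideal sheaf and `E` a boundary on `X`.

**Theorem** (`CentreSeq.exists_modelDataAt`). If the induced sequence `s^*jK` is a resolution
(BGMW Def. 3.1.3) of the marked ideal `(X_K, jK^*𝓘, jK^*E, 1)`, then `s` carries model data over
some `D(a)`, `a ≠ 0` (`CentreSeq.ModelDataAt`, `SpreadModelDataRestrict.lean`). One step: from the
admissibility of the first centre `jK^*C` (support, simple normal crossings with `jK^*E`,
regularity) one spreads — `𝓘 ⊆ C` (BGMW Lemma 3.2.1, `MarkedIdeal.ideal_le_pow`, then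
`SpreadIdealSheafInclusion.lean`); the equality over `D(a)` of members of `E` with the same generic
restriction; the smoothness of the saturated strata, the Cartier locus of the members of `E` on
them and the smoothness of their zero schemes (`SncModelSpread.lean`); the smoothness of the
exceptional divisor and of the strict transforms of the members of `E`, and the relative Cartier
property of the exceptional divisor on them (their generic fibres are members and strata of the
transformed boundary, which keeps simple normal crossings, `BlowupSNC.lean`; a strict transform
equal to the exceptional divisor is trivial, `BoundaryEquivalence.lean`) —, each over some
`D(aᵢ)`, and recurses on the blow-up (generic fibre the blow-up of `X_K`, flat base change), taking
the product of the finitely many `aᵢ` (`ModelDataAt.mono`).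

## Sources

* A. Grothendieck, J. Dieudonné, EGA IV₃ (1966) §8–§9, IV₄ (1967) §17 (spreading out from the
  generic fibre). [folklore]
* E. Bierstone, D. Grigoriev, P. Milman, J. Włodarczyk, arXiv:1206.3090, Def. 3.1.3,
  Lemma 3.2.1. [BierstoneGrigorievMilmanWlodarczyk2011]
-/

noncomputable section

open CategoryTheory CategoryTheory.Limits AlgebraicGeometry TopologicalSpace PrimeSpectrum

namespace Literature.AlgebraicGeometry.Resolution

universe u

open Scheme.IdealSheafData

/-! ## Generalities: finitely many shrinkings, chosen versus given generic fibre, stalks over opens -/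

section General

variable {A : Type u} [CommRing A]

/-- **Finitely many shrinkings of the base combine**: if each of finitely many properties holds
over some `D(aᵢ)`, `aᵢ ≠ 0`, and the properties are inherited by smaller basic opens, then all hold
over `D(∏ aᵢ)`, `∏ aᵢ ≠ 0` (`A` a domain). [folklore] -/
theorem exists_ne_zero_forall_mem_list [IsDomain A] {ι : Type*} (P : ι → A → Prop)
    (hP : ∀ i (a b : A), basicOpen b ≤ basicOpen a → P i a → P i b) :
    ∀ l : List ι, (∀ i ∈ l, ∃ a : A, a ≠ 0 ∧ P i a) → ∃ a : A, a ≠ 0 ∧ ∀ i ∈ l, P i a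
  | [], _ => ⟨1, one_ne_zero, fun i hi => by simp at hi⟩
  | i :: l, h => by
    obtain ⟨a, ha, hia⟩ := h i (List.mem_cons_self ..)
    obtain ⟨b, hb, hlb⟩ := exists_ne_zero_forall_mem_list P hP l
      fun i' hi' => h i' (List.mem_cons_of_mem _ hi')
    refine ⟨a * b, mul_ne_zero ha hb, fun i' hi' => ?_⟩
    rcases List.mem_cons.mp hi' with rfl | hi'
    · exact hP _ a (a * b) (by rw [basicOpen_mul]; exact inf_le_left) hia
    · exact hP _ b (a * b) (by rw [basicOpen_mul]; exact inf_le_right) (hlb i' hi')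

/-- Two properties over basic opens combine. [folklore] -/
theorem exists_ne_zero_and [IsDomain A] {P Q : A → Prop}
    (hP : ∀ a b : A, basicOpen b ≤ basicOpen a → P a → P b)
    (hQ : ∀ a b : A, basicOpen b ≤ basicOpen a → Q a → Q b)
    (h₁ : ∃ a : A, a ≠ 0 ∧ P a) (h₂ : ∃ a : A, a ≠ 0 ∧ Q a) : ∃ a : A, a ≠ 0 ∧ P a ∧ Q a := by
  obtain ⟨a, ha, hPa⟩ := h₁
  obtain ⟨b, hb, hQb⟩ := h₂
  exact ⟨a * b, mul_ne_zero ha hb,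
    hP a _ (by rw [basicOpen_mul]; exact inf_le_left) hPa,
    hQ b _ (by rw [basicOpen_mul]; exact inf_le_right) hQb⟩

variable {X : Scheme.{u}}

/-- Ideals with the same extension along a ring isomorphism are equal. [folklore] -/
theorem ideal_eq_of_map_ringEquiv_eq {R S : Type*} [CommRing R] [CommRing S] (e : R ≃+* S)
    {P Q : Ideal R} (h : P.map e.toRingHom = Q.map e.toRingHom) : P = Q := by
  have h1 : (P.map e.toRingHom).map e.symm.toRingHom = (Q.map e.toRingHom).map e.symm.toRingHom := by
    rw [h]
  have h2 : e.symm.toRingHom.comp e.toRingHom = RingHom.id _ := RingHom.ext fun r => e.symm_apply_apply r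
  rwa [Ideal.map_map, Ideal.map_map, h2, Ideal.map_id, Ideal.map_id] at h1

/-- Ideals with ordered extensions along a ring isomorphism are ordered. [folklore] -/
theorem ideal_le_of_map_ringEquiv_le {R S : Type*} [CommRing R] [CommRing S] (e : R ≃+* S)
    {P Q : Ideal R} (h : P.map e.toRingHom ≤ Q.map e.toRingHom) : P ≤ Q := by
  have h1 : (P.map e.toRingHom).map e.symm.toRingHom ≤ (Q.map e.toRingHom).map e.symm.toRingHom :=
    Ideal.map_mono h
  have h2 : e.symm.toRingHom.comp e.toRingHom = RingHom.id _ := RingHom.ext fun r => e.symm_apply_apply r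
  rwa [Ideal.map_map, Ideal.map_map, h2, Ideal.map_id, Ideal.map_id] at h1

/-- **Stalks from an equality of restrictions to an open**: if `I|_U = J|_U` then `I_x = J_x` at
the points of `U`. [folklore] -/
theorem stalkIdeal_eq_of_comap_ι_eq {U : X.Opens} {I J : X.IdealSheafData}
    (h : I.comap U.ι = J.comap U.ι) {x : X} (hx : x ∈ U) : stalkIdeal I x = stalkIdeal J x := by
  have key := congrArg (fun L => stalkIdeal L (⟨x, hx⟩ : U)) h
  simp only [stalkIdeal_comap_eq_map_stalkMap] at key
  exact ideal_eq_of_map_ringEquiv_eq (asIso (U.ι.stalkMap ⟨x, hx⟩)).commRingCatIsoToRingEquiv key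

/-- **Stalks from an inequality of restrictions to an open.** [folklore] -/
theorem stalkIdeal_le_of_comap_ι_le {U : X.Opens} {I J : X.IdealSheafData}
    (h : I.comap U.ι ≤ J.comap U.ι) {x : X} (hx : x ∈ U) : stalkIdeal I x ≤ stalkIdeal J x := by
  have key : stalkIdeal (I.comap U.ι) ⟨x, hx⟩ ≤ stalkIdeal (J.comap U.ι) ⟨x, hx⟩ := stalkIdeal_mono h _
  rw [stalkIdeal_comap_eq_map_stalkMap, stalkIdeal_comap_eq_map_stalkMap] at key
  exact ideal_le_of_map_ringEquiv_le (asIso (U.ι.stalkMap ⟨x, hx⟩)).commRingCatIsoToRingEquiv key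

/-- **Stalks from the triviality of a restriction to an open.** [folklore] -/
theorem stalkIdeal_eq_top_of_comap_ι_eq_top {U : X.Opens} {I : X.IdealSheafData}
    (h : I.comap U.ι = ⊤) {x : X} (hx : x ∈ U) : stalkIdeal I x = ⊤ := by
  rw [← comap_top U.ι] at h
  rw [stalkIdeal_eq_of_comap_ι_eq h hx, stalkIdeal_top]

variable (K : Type u) [Field K] [Algebra A K] {XK : Scheme.{u}} (q : X ⟶ Spec (.of A))
  {jK : XK ⟶ X} {qK : XK ⟶ Spec (.of K)} (HK : IsPullback jK qK q (specOfAlgebra A K))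

include HK in
/-- Pull-backs along Mathlib's chosen generic fibre versus a given one. [folklore] -/
theorem comap_pullback_fst_eq_comap_comap (I : X.IdealSheafData) :
    I.comap (pullback.fst q (specOfAlgebra A K)) = (I.comap jK).comap HK.isoPullback.inv := by
  rw [← comap_comp, HK.isoPullback_inv_fst]

end General

namespace CentreSeq

variable {A : Type u} [CommRing A]

/-! ## Monotonicity of model data in the basic open -/

/-- **Model data over `D(a)` give model data over every smaller `D(b)`.** [folklore] -/
theorem ModelDataAt.mono {a b : A} (hab : basicOpen b ≤ basicOpen a) :
    ∀ {X XK : Scheme.{u}} {q : X ⟶ Spec (.of A)} {jK : XK ⟶ X} {s : CentreSeq X}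
      {𝓘 : X.IdealSheafData} {E : List X.IdealSheafData},
      ModelDataAt a q jK s 𝓘 E → ModelDataAt b q jK s 𝓘 E
  | _, _, q, _, nil _, 𝓘, _, h => fun x hx => h x (hab hx)
  | X, _, q, jK, cons C rest, 𝓘, E, h => by
    obtain ⟨hinj, hIC, hsm, hcart, hexc, hbd, hrest⟩ := h
    refine ⟨fun D hD D' hD' heq x hx => hinj D hD D' hD' heq x (hab hx),
      fun x hx => hIC x (hab hx),
      fun B T hB hT hi z hz => hsm B T hB hT hi z (hab hz),
      fun B T hB hT hi D₀ hD₀E hD₀B hD₀T => ⟨fun z hz => (hcart B T hB hT hi D₀ hD₀E hD₀B hD₀T).1 z (hab hz),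
        fun z hz => (hcart B T hB hT hi D₀ hD₀E hD₀B hD₀T).2 z (hab hz)⟩,
      fun z hz => hexc z (hab hz), fun K hK => ?_, ModelDataAt.mono hab hrest⟩
    rcases hbd K hK with ⟨h1, h2, h3⟩ | h4
    · exact Or.inl ⟨fun z hz => h1 z (hab hz), fun z hz => h2 z (hab hz), fun z hz => h3 z (hab hz)⟩
    · exact Or.inr fun x hx => h4 x (hab hx)

/-! ## Spreading out -/

variable [IsDomain A] [IsNoetherianRing A] (K : Type u) [Field K] [CharZero K] [Algebra A K]
  [IsFractionRing A K]

/-- **A multiple blow-up whose generic fibre is a resolution carries model data over some dense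
open of the base** (see the module docstring).
[cite: BierstoneGrigorievMilmanWlodarczyk2011, Def. 3.1.3 with Lemma 3.2.1] -/
theorem exists_modelDataAt :
    ∀ {X XK : Scheme.{u}} [IsLocallyNoetherian XK] (s : CentreSeq X) (q : X ⟶ Spec (.of A))
      [LocallyOfFiniteType q] [QuasiCompact q] (jK : XK ⟶ X) (qK : XK ⟶ Spec (.of K))
      [LocallyOfFiniteType qK], IsPullback jK qK q (specOfAlgebra A K) →
      ∀ (𝓘 : X.IdealSheafData) (E : List X.IdealSheafData),
        (s.comap jK).IsResolutionOf ⟨𝓘.comap jK, E.map (fun D => D.comap jK), 1⟩ →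
        ∃ a : A, a ≠ 0 ∧ ModelDataAt a q jK s 𝓘 E
  | X, XK, _, nil _, q, _, _, jK, qK, _, HK, 𝓘, E, hres => by
    haveI : IsLocallyNoetherian X := LocallyOfFiniteType.isLocallyNoetherian q
    haveI : CompactSpace X := QuasiCompact.compactSpace_of_compactSpace q
    -- `jK^*𝓘 = 𝒪`, spread to `D(a)`
    have htop : 𝓘.comap jK = ⊤ := by
      have h := ((isResolutionOf_nil_iff _).mp hres)
      rw [MarkedIdeal.support_of_mult_eq_one _ rfl] at h
      change (((𝓘.comap jK).support : Closeds XK) : Set XK) = ∅ at h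
      rw [← support_eq_bot_iff]
      ext x
      simpa using Set.ext_iff.mp h x
    have htop' : 𝓘.comap (pullback.fst q (specOfAlgebra A K)) = ⊤ := by
      rw [comap_pullback_fst_eq_comap_comap K q HK, htop, comap_top]
    obtain ⟨a, ha, h⟩ := exists_comap_ι_eq_top_of_generic K q 𝓘 htop'
    exact ⟨a, ha, fun x hx => stalkIdeal_eq_top_of_comap_ι_eq_top h hx⟩
  | X, XK, _, cons C rest, q, _, _, jK, qK, _, HK, 𝓘, E, hres => by
    classical
    haveI : IsLocallyNoetherian X := LocallyOfFiniteType.isLocallyNoetherian q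
    haveI : CompactSpace X := QuasiCompact.compactSpace_of_compactSpace q
    haveI : Flat jK := MorphismProperty.of_isPullback HK.flip (flat_specMap_fractionRing (A := A) K)
    haveI : IsProper (blowup.π C) := (blowup.isBlowup C).isProper
    haveI : IsLocallyNoetherian (blowup C) := LocallyOfFiniteType.isLocallyNoetherian (blowup.π C)
    haveI : IsProper (blowup.π (C.comap jK)) := (blowup.isBlowup (C.comap jK)).isProper
    haveI : IsLocallyNoetherian (blowup (C.comap jK)) :=
      LocallyOfFiniteType.isLocallyNoetherian (blowup.π (C.comap jK))
    -- notation
    set M : MarkedIdeal X := ⟨𝓘, E, 1⟩ with hM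
    set g : blowup (C.comap jK) ⟶ blowup C := blowup.comapMap C jK with hg
    haveI : Flat g := blowup.comapMap_mem @Flat C jK inferInstance
    have hsq : g ≫ blowup.π C = blowup.π (C.comap jK) ≫ jK := blowup.comapMap_π C jK
    have HK₁ : IsPullback g (blowup.π (C.comap jK) ≫ qK) (blowup.π C ≫ q) (specOfAlgebra A K) :=
      (blowup.isPullback_comapMap C jK).paste_vert HK
    haveI : LocallyOfFiniteType (blowup.π C ≫ q) := inferInstance
    haveI : QuasiCompact (blowup.π C ≫ q) := inferInstance
    haveI : LocallyOfFiniteType (blowup.π (C.comap jK) ≫ qK) := inferInstance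
    -- the generic admissibility data
    have hres' : (cons (C.comap jK) (rest.comap g)).IsResolutionOf (M.comap jK) := hres
    obtain ⟨hsupp, hsnc, -, hrestK⟩ := (cons_isResolutionOf_iff _ _ _).mp hres'
    have hsnc' : HasSNCWith (E.map fun D => D.comap jK) (C.comap jK) := hsnc
    -- the transformed boundary keeps simple normal crossings on the generic fibre
    have hE₁K : HasSNC ((E.map fun D => D.comap jK).map (strictTransformIdeal (blowup.π (C.comap jK)) (C.comap jK)) ++
        [(C.comap jK).comap (blowup.π (C.comap jK))]) :=
      hsnc'.hasSNC_transform (blowup.isBlowup (C.comap jK))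
    have hexcg : (C.comap (blowup.π C)).comap g = (C.comap jK).comap (blowup.π (C.comap jK)) := by
      rw [← Scheme.IdealSheafData.comap_comp, ← Scheme.IdealSheafData.comap_comp, hsq]
    have hexc_mem : (C.comap jK).comap (blowup.π (C.comap jK)) ∈
        (E.map fun D => D.comap jK).map (strictTransformIdeal (blowup.π (C.comap jK)) (C.comap jK)) ++
          [(C.comap jK).comap (blowup.π (C.comap jK))] :=
      List.mem_append_right _ (List.mem_singleton_self _)
    have hstr : ∀ K₀ : X.IdealSheafData, (strictTransformIdeal (blowup.π C) C K₀).comap g =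
        strictTransformIdeal (blowup.π (C.comap jK)) (C.comap jK) (K₀.comap jK) := fun K₀ =>
      comap_strictTransformIdeal_of_flat jK hsq C K₀
    have hstr_mem : ∀ K₀ ∈ E, strictTransformIdeal (blowup.π (C.comap jK)) (C.comap jK) (K₀.comap jK) ∈
        (E.map fun D => D.comap jK).map (strictTransformIdeal (blowup.π (C.comap jK)) (C.comap jK)) ++
          [(C.comap jK).comap (blowup.π (C.comap jK))] := fun K₀ hK₀ =>
      List.mem_append_left _ (List.mem_map.mpr ⟨K₀.comap jK, List.mem_map.mpr ⟨K₀, hK₀, rfl⟩, rfl⟩)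
    -- ### (1) injectivity clause
    have h1 : ∃ a : A, a ≠ 0 ∧ ∀ D ∈ E, ∀ D' ∈ E, D.comap jK = D'.comap jK →
        ∀ x : X, q x ∈ (basicOpen a : Set (PrimeSpectrum A)) → stalkIdeal D x = stalkIdeal D' x := by
      obtain ⟨a, ha, h⟩ := exists_ne_zero_forall_mem_list
        (fun (p : X.IdealSheafData × X.IdealSheafData) (a : A) => p.1.comap jK = p.2.comap jK →
          ∀ x : X, q x ∈ (basicOpen a : Set (PrimeSpectrum A)) → stalkIdeal p.1 x = stalkIdeal p.2 x)
        (fun p a b hab hp heq x hx => hp heq x (hab hx)) (E ×ˢ E) fun p _ => by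
          by_cases heq : p.1.comap jK = p.2.comap jK
          · have heq' : p.1.comap (pullback.fst q (specOfAlgebra A K)) =
                p.2.comap (pullback.fst q (specOfAlgebra A K)) := by
              rw [comap_pullback_fst_eq_comap_comap K q HK, comap_pullback_fst_eq_comap_comap K q HK, heq]
            obtain ⟨a, ha, h⟩ := exists_comap_ι_eq_comap_ι_of_generic K q p.1 p.2 heq'
            exact ⟨a, ha, fun _ x hx => stalkIdeal_eq_of_comap_ι_eq h hx⟩
          · exact ⟨1, one_ne_zero, fun h => absurd h heq⟩
      exact ⟨a, ha, fun D hD D' hD' heq x hx => h (D, D') (List.pair_mem_product.mpr ⟨hD, hD'⟩) heq x hx⟩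
    -- ### (2) `𝓘 ⊆ C`
    have h2 : ∃ a : A, a ≠ 0 ∧ ∀ x : X, q x ∈ (basicOpen a : Set (PrimeSpectrum A)) →
        stalkIdeal 𝓘 x ≤ stalkIdeal C x := by
      have hle : 𝓘.comap jK ≤ C.comap jK := by
        have h := (M.comap jK).ideal_le_pow hsupp hsnc'
        rwa [MarkedIdeal.comap_mult, hM, pow_one] at h
      have hle' : 𝓘.comap (pullback.fst q (specOfAlgebra A K)) ≤ C.comap (pullback.fst q (specOfAlgebra A K)) := by
        rw [comap_pullback_fst_eq_comap_comap K q HK, comap_pullback_fst_eq_comap_comap K q HK]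
        exact comap_mono _ hle
      obtain ⟨a, ha, h⟩ := exists_comap_ι_le_comap_ι_of_generic K q 𝓘 C hle'
      exact ⟨a, ha, fun x hx => stalkIdeal_le_of_comap_ι_le h hx⟩
    -- ### (3) smooth saturated strata
    have h3 : ∃ a : A, a ≠ 0 ∧ ∀ B T : Finset X.IdealSheafData, (∀ K ∈ B, K ∈ E) → (∀ K ∈ T, K ∈ E) →
        Set.InjOn (fun D : X.IdealSheafData => D.comap jK) B →
        ∀ z : (satCentre C B ⊔ T.sup id).subscheme,
          ((satCentre C B ⊔ T.sup id).subschemeι ≫ q) z ∈ (basicOpen a : Set (PrimeSpectrum A)) →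
          (((satCentre C B ⊔ T.sup id).subschemeι ≫ q).stalkMap z).hom.FormallySmooth := by
      obtain ⟨a, ha, h⟩ := exists_ne_zero_forall_mem_list
        (fun (p : Finset X.IdealSheafData × Finset X.IdealSheafData) (a : A) =>
          (∀ K ∈ p.2, K ∈ E) → Set.InjOn (fun D : X.IdealSheafData => D.comap jK) p.1 →
          ∀ z : (satCentre C p.1 ⊔ p.2.sup id).subscheme,
            ((satCentre C p.1 ⊔ p.2.sup id).subschemeι ≫ q) z ∈ (basicOpen a : Set (PrimeSpectrum A)) →
            (((satCentre C p.1 ⊔ p.2.sup id).subschemeι ≫ q).stalkMap z).hom.FormallySmooth)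
        (fun p a b hab hp hT hi z hz => hp hT hi z (hab hz))
        (E.toFinset.powerset.toList ×ˢ E.toFinset.powerset.toList) fun p _ => by
          by_cases hc : (∀ K ∈ p.2, K ∈ E) ∧ Set.InjOn (fun D : X.IdealSheafData => D.comap jK) p.1
          · haveI := locallyOfFinitePresentation_of_isNoetherianRing_base ((satCentre C p.1 ⊔ p.2.sup id).subschemeι ≫ q)
            obtain ⟨a, ha, h⟩ := hsnc'.exists_forall_mem_smoothLocus_satCentre_sup K q HK p.1 p.2 hc.1 hc.2
            exact ⟨a, ha, fun _ _ z hz => Scheme.Hom.mem_smoothLocus.mp (h z hz)⟩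
          · exact ⟨1, one_ne_zero, fun hT hi => absurd ⟨hT, hi⟩ hc⟩
      refine ⟨a, ha, fun B T hB hT hi z hz => h (B, T) ?_ hT hi z hz⟩
      refine List.pair_mem_product.mpr ⟨?_, ?_⟩
      · exact Finset.mem_toList.mpr (Finset.mem_powerset.mpr fun K hK => List.mem_toFinset.mpr (hB K hK))
      · exact Finset.mem_toList.mpr (Finset.mem_powerset.mpr fun K hK => List.mem_toFinset.mpr (hT K hK))
    -- ### (4) relative Cartier members and smooth zero schemes
    have h4 : ∃ a : A, a ≠ 0 ∧ ∀ B T : Finset X.IdealSheafData, (∀ K ∈ B, K ∈ E) → (∀ K ∈ T, K ∈ E) →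
        Set.InjOn (fun D : X.IdealSheafData => D.comap jK) B →
        ∀ D₀ ∈ E, D₀ ∈ B → (∀ K ∈ T, K.comap jK ≠ D₀.comap jK) →
          (∀ z : (satCentre C B ⊔ T.sup id).subscheme,
            ((satCentre C B ⊔ T.sup id).subschemeι ≫ q) z ∈ (basicOpen a : Set (PrimeSpectrum A)) →
            z ∈ cartierLocus (D₀.comap (satCentre C B ⊔ T.sup id).subschemeι)) ∧
          (∀ z : (D₀.comap (satCentre C B ⊔ T.sup id).subschemeι).subscheme,
            ((D₀.comap (satCentre C B ⊔ T.sup id).subschemeι).subschemeι ≫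
                (satCentre C B ⊔ T.sup id).subschemeι ≫ q) z ∈ (basicOpen a : Set (PrimeSpectrum A)) →
            (((D₀.comap (satCentre C B ⊔ T.sup id).subschemeι).subschemeι ≫
              (satCentre C B ⊔ T.sup id).subschemeι ≫ q).stalkMap z).hom.FormallySmooth) := by
      obtain ⟨a, ha, h⟩ := exists_ne_zero_forall_mem_list
        (fun (p : (Finset X.IdealSheafData × Finset X.IdealSheafData) × X.IdealSheafData) (a : A) =>
          (∀ K ∈ p.1.2, K ∈ E) → Set.InjOn (fun D : X.IdealSheafData => D.comap jK) p.1.1 →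
          p.2 ∈ E → p.2 ∈ p.1.1 → (∀ K ∈ p.1.2, K.comap jK ≠ p.2.comap jK) →
          (∀ z : (satCentre C p.1.1 ⊔ p.1.2.sup id).subscheme,
            ((satCentre C p.1.1 ⊔ p.1.2.sup id).subschemeι ≫ q) z ∈ (basicOpen a : Set (PrimeSpectrum A)) →
            z ∈ cartierLocus (p.2.comap (satCentre C p.1.1 ⊔ p.1.2.sup id).subschemeι)) ∧
          (∀ z : (p.2.comap (satCentre C p.1.1 ⊔ p.1.2.sup id).subschemeι).subscheme,
            ((p.2.comap (satCentre C p.1.1 ⊔ p.1.2.sup id).subschemeι).subschemeι ≫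
                (satCentre C p.1.1 ⊔ p.1.2.sup id).subschemeι ≫ q) z ∈ (basicOpen a : Set (PrimeSpectrum A)) →
            (((p.2.comap (satCentre C p.1.1 ⊔ p.1.2.sup id).subschemeι).subschemeι ≫
              (satCentre C p.1.1 ⊔ p.1.2.sup id).subschemeι ≫ q).stalkMap z).hom.FormallySmooth))
        (fun p a b hab hp hT hi hE hB hne =>
          ⟨fun z hz => (hp hT hi hE hB hne).1 z (hab hz), fun z hz => (hp hT hi hE hB hne).2 z (hab hz)⟩)
        ((E.toFinset.powerset.toList ×ˢ E.toFinset.powerset.toList) ×ˢ E) fun p _ => by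
          by_cases hc : (∀ K ∈ p.1.2, K ∈ E) ∧ Set.InjOn (fun D : X.IdealSheafData => D.comap jK) p.1.1 ∧
              p.2 ∈ E ∧ p.2 ∈ p.1.1 ∧ (∀ K ∈ p.1.2, K.comap jK ≠ p.2.comap jK)
          · obtain ⟨hT, hi, hE, hB, hne⟩ := hc
            haveI := locallyOfFinitePresentation_of_isNoetherianRing_base
              ((p.2.comap (satCentre C p.1.1 ⊔ p.1.2.sup id).subschemeι).subschemeι ≫
                (satCentre C p.1.1 ⊔ p.1.2.sup id).subschemeι ≫ q)
            obtain ⟨a, ha, hA⟩ := hsnc'.exists_forall_mem_cartierLocus_satCentre_sup K q HK p.1.1 p.1.2 hT hi hE hB hne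
            obtain ⟨b, hb, hB'⟩ := hsnc'.exists_forall_mem_smoothLocus_zeroScheme_satCentre_sup K q HK p.1.1 p.1.2 hT hi hE
            refine ⟨a * b, mul_ne_zero ha hb, fun _ _ _ _ _ => ⟨fun z hz => hA z ?_, fun z hz => ?_⟩⟩
            · have hle : basicOpen (a * b) ≤ basicOpen a := by rw [basicOpen_mul]; exact inf_le_left
              exact hle hz
            · have hle : basicOpen (a * b) ≤ basicOpen b := by rw [basicOpen_mul]; exact inf_le_right
              exact Scheme.Hom.mem_smoothLocus.mp (hB' z (hle hz))
          · exact ⟨1, one_ne_zero, fun hT hi hE hB hne => absurd ⟨hT, hi, hE, hB, hne⟩ hc⟩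
      refine ⟨a, ha, fun B T hB hT hi D₀ hD₀E hD₀B hD₀T => h ((B, T), D₀) ?_ hT hi hD₀E hD₀B hD₀T⟩
      refine List.pair_mem_product.mpr ⟨List.pair_mem_product.mpr ⟨?_, ?_⟩, hD₀E⟩
      · exact Finset.mem_toList.mpr (Finset.mem_powerset.mpr fun K hK => List.mem_toFinset.mpr (hB K hK))
      · exact Finset.mem_toList.mpr (Finset.mem_powerset.mpr fun K hK => List.mem_toFinset.mpr (hT K hK))
    -- ### (5) smooth exceptional divisor
    have h5 : ∃ a : A, a ≠ 0 ∧ ∀ z : (C.comap (blowup.π C)).subscheme,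
        ((C.comap (blowup.π C)).subschemeι ≫ blowup.π C ≫ q) z ∈ (basicOpen a : Set (PrimeSpectrum A)) →
        (((C.comap (blowup.π C)).subschemeι ≫ blowup.π C ≫ q).stalkMap z).hom.FormallySmooth := by
      have hreg : Scheme.IsRegular ((C.comap (blowup.π C)).comap g).subscheme := by
        rw [hexcg]
        have h := hE₁K.isRegular_subscheme_finsetSup {(C.comap jK).comap (blowup.π (C.comap jK))}
          (fun K₀ hK₀ => by rw [Finset.mem_singleton] at hK₀; rw [hK₀]; exact hexc_mem)
        rwa [Finset.sup_singleton] at h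
      haveI := locallyOfFinitePresentation_of_isNoetherianRing_base
        ((C.comap (blowup.π C)).subschemeι ≫ blowup.π C ≫ q)
      obtain ⟨a, ha, h⟩ := exists_forall_mem_smoothLocus_of_isRegular_comap K (blowup.π C ≫ q) HK₁ _ hreg
      exact ⟨a, ha, fun z hz => Scheme.Hom.mem_smoothLocus.mp (h z hz)⟩
    -- ### (6) strict transforms of the members of `E`
    have h6 : ∃ a : A, a ≠ 0 ∧ ∀ K₀ ∈ E,
        ((∀ z : (strictTransformIdeal (blowup.π C) C K₀).subscheme,
            ((strictTransformIdeal (blowup.π C) C K₀).subschemeι ≫ blowup.π C ≫ q) z ∈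
                (basicOpen a : Set (PrimeSpectrum A)) →
            (((strictTransformIdeal (blowup.π C) C K₀).subschemeι ≫ blowup.π C ≫ q).stalkMap z).hom.FormallySmooth) ∧
          (∀ z : (strictTransformIdeal (blowup.π C) C K₀).subscheme,
            ((strictTransformIdeal (blowup.π C) C K₀).subschemeι ≫ blowup.π C ≫ q) z ∈
                (basicOpen a : Set (PrimeSpectrum A)) →
            z ∈ cartierLocus ((C.comap (blowup.π C)).comap
              (strictTransformIdeal (blowup.π C) C K₀).subschemeι)) ∧
          (∀ z : ((C.comap (blowup.π C)).comap (strictTransformIdeal (blowup.π C) C K₀).subschemeι).subscheme,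
            ((((C.comap (blowup.π C)).comap
              (strictTransformIdeal (blowup.π C) C K₀).subschemeι)).subschemeι ≫
                (strictTransformIdeal (blowup.π C) C K₀).subschemeι ≫ blowup.π C ≫ q) z ∈
                (basicOpen a : Set (PrimeSpectrum A)) →
            (((((C.comap (blowup.π C)).comap
              (strictTransformIdeal (blowup.π C) C K₀).subschemeι)).subschemeι ≫
                (strictTransformIdeal (blowup.π C) C K₀).subschemeι ≫ blowup.π C ≫ q).stalkMap z).hom.FormallySmooth)) ∨
        (∀ x : blowup C, (blowup.π C ≫ q) x ∈ (basicOpen a : Set (PrimeSpectrum A)) →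
          stalkIdeal (strictTransformIdeal (blowup.π C) C K₀) x = ⊤) := by
      refine exists_ne_zero_forall_mem_list _ (fun K₀ a b hab hp => ?_) E fun K₀ hK₀ => ?_
      · rcases hp with ⟨hp1, hp2, hp3⟩ | hp4
        · exact Or.inl ⟨fun z hz => hp1 z (hab hz), fun z hz => hp2 z (hab hz), fun z hz => hp3 z (hab hz)⟩
        · exact Or.inr fun x hx => hp4 x (hab hx)
      set S := strictTransformIdeal (blowup.π C) C K₀ with hSdef
      set SK := strictTransformIdeal (blowup.π (C.comap jK)) (C.comap jK) (K₀.comap jK) with hSKdef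
      have hSg : S.comap g = SK := hstr K₀
      by_cases hSKtop : SK = ⊤
      · -- the generic strict transform is trivial: spread `S = 𝒪`
        have h' : S.comap (pullback.fst (blowup.π C ≫ q) (specOfAlgebra A K)) = ⊤ := by
          rw [comap_pullback_fst_eq_comap_comap K (blowup.π C ≫ q) HK₁, hSg, hSKtop, comap_top]
        haveI : CompactSpace (blowup C) := QuasiCompact.compactSpace_of_compactSpace (blowup.π C)
        obtain ⟨a, ha, h⟩ := exists_comap_ι_eq_top_of_generic K (blowup.π C ≫ q) S h'
        exact ⟨a, ha, Or.inr fun x hx => stalkIdeal_eq_top_of_comap_ι_eq_top h hx⟩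
      · -- generically: `V(S_K)` regular, `D_K` Cartier on it (as `S_K ≠ D_K`), `V(S_K ⊔ D_K)` regular
        have hne : SK ≠ (C.comap jK).comap (blowup.π (C.comap jK)) := by
          intro heq
          have hsupp_ne : SK.support ≠ ⊥ := fun he => hSKtop ((support_eq_bot_iff _).mp he)
          obtain ⟨z, hz⟩ : (((SK.support : Closeds (blowup (C.comap jK))) : Set _)).Nonempty := by
            by_contra hemp
            rw [Set.not_nonempty_iff_eq_empty] at hemp
            exact hsupp_ne (Closeds.ext (by rw [Closeds.coe_bot]; exact hemp))
          have hz1 : z ∈ SK.support := hz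
          have hz' : z ∈ ((C.comap jK).comap (blowup.π (C.comap jK))).support := by rw [← heq]; exact hz1
          exact stalkIdeal_strictTransformIdeal_ne_stalkIdeal_comap hsnc'
            (blowup.isBlowup (C.comap jK)) (List.mem_map.mpr ⟨K₀, hK₀, rfl⟩) hz' hz1
            (by rw [hSKdef.symm.trans heq])
        have hregS : Scheme.IsRegular ((S.comap g)).subscheme := by
          rw [hSg]
          have h := hE₁K.isRegular_subscheme_finsetSup {SK}
            (fun K₁ hK₁ => by rw [Finset.mem_singleton] at hK₁; rw [hK₁]; exact hstr_mem K₀ hK₀)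
          rwa [Finset.sup_singleton] at h
        have hcartS : IsEffectiveCartier ((((C.comap (blowup.π C)).comap g)).comap ((S.comap g)).subschemeι) := by
          rw [hSg, hexcg]
          have h := (hE₁K : HasSNCWith _ ⊤).isEffectiveCartier_comap_subschemeι_finsetSup {SK}
            (fun K₁ hK₁ => by rw [Finset.mem_singleton] at hK₁; rw [hK₁]; exact hstr_mem K₀ hK₀)
            hexc_mem (by rw [Finset.mem_singleton]; exact fun h => hne h.symm)
          rwa [Finset.sup_singleton] at h
        have hregSD : Scheme.IsRegular (((S ⊔ C.comap (blowup.π C)).comap g)).subscheme := by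
          rw [(map_gc g).l_sup, hSg, hexcg]
          have h := hE₁K.isRegular_subscheme_finsetSup {SK, (C.comap jK).comap (blowup.π (C.comap jK))}
            (fun K₁ hK₁ => by
              rcases Finset.mem_insert.mp hK₁ with rfl | hK₁
              · exact hstr_mem K₀ hK₀
              · rw [Finset.mem_singleton] at hK₁; rw [hK₁]; exact hexc_mem)
          rwa [Finset.sup_insert, Finset.sup_singleton, id] at h
        haveI := locallyOfFinitePresentation_of_isNoetherianRing_base (S.subschemeι ≫ blowup.π C ≫ q)
        haveI := locallyOfFinitePresentation_of_isNoetherianRing_base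
          ((((C.comap (blowup.π C)).comap S.subschemeι)).subschemeι ≫ S.subschemeι ≫ blowup.π C ≫ q)
        obtain ⟨a₁, ha₁, k1⟩ := exists_forall_mem_smoothLocus_of_isRegular_comap K (blowup.π C ≫ q) HK₁ S hregS
        obtain ⟨a₂, ha₂, k2⟩ := exists_forall_mem_cartierLocus_comap_subschemeι K (blowup.π C ≫ q) HK₁ S _ hcartS
        obtain ⟨a₃, ha₃, k3⟩ := exists_forall_mem_smoothLocus_comap_subschemeι K (blowup.π C ≫ q) HK₁ S _ hregSD
        refine ⟨a₁ * a₂ * a₃, mul_ne_zero (mul_ne_zero ha₁ ha₂) ha₃, Or.inl ⟨?_, ?_, ?_⟩⟩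
        · intro z hz
          refine Scheme.Hom.mem_smoothLocus.mp (k1 z ?_)
          have : basicOpen (a₁ * a₂ * a₃) ≤ basicOpen a₁ := by
            rw [basicOpen_mul, basicOpen_mul]; exact inf_le_left.trans inf_le_left
          exact this hz
        · intro z hz
          refine k2 z ?_
          have : basicOpen (a₁ * a₂ * a₃) ≤ basicOpen a₂ := by
            rw [basicOpen_mul, basicOpen_mul]; exact inf_le_left.trans inf_le_right
          exact this hz
        · intro z hz
          refine Scheme.Hom.mem_smoothLocus.mp (k3 z ?_)
          have : basicOpen (a₁ * a₂ * a₃) ≤ basicOpen a₃ := by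
            rw [basicOpen_mul]; exact inf_le_right
          exact this hz
    -- ### (7) the tail
    have h7 : ∃ a : A, a ≠ 0 ∧ ModelDataAt a (blowup.π C ≫ q) g rest
        (controlledTransform (blowup.π C) C 𝓘 1)
        (E.map (strictTransformIdeal (blowup.π C) C) ++ [C.comap (blowup.π C)]) := by
      have htr : (M.comap jK).transform (blowup.π (C.comap jK)) (C.comap jK) =
          (M.transform (blowup.π C) C).comap g :=
        MarkedIdeal.transform_comap_of_flat' jK hsq M C
      refine exists_modelDataAt rest (blowup.π C ≫ q) g (blowup.π (C.comap jK) ≫ qK) HK₁ _ _ ?_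
      rw [htr] at hrestK
      exact hrestK
    -- ### combine
    obtain ⟨a₁, ha₁, k₁⟩ := h1
    obtain ⟨a₂, ha₂, k₂⟩ := h2
    obtain ⟨a₃, ha₃, k₃⟩ := h3
    obtain ⟨a₄, ha₄, k₄⟩ := h4
    obtain ⟨a₅, ha₅, k₅⟩ := h5
    obtain ⟨a₆, ha₆, k₆⟩ := h6
    obtain ⟨a₇, ha₇, k₇⟩ := h7
    -- basic opens of products
    have hl : ∀ x y : A, basicOpen (x * y) ≤ basicOpen x := fun x y => by
      rw [basicOpen_mul]; exact inf_le_left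
    have hr : ∀ x y : A, basicOpen (x * y) ≤ basicOpen y := fun x y => by
      rw [basicOpen_mul]; exact inf_le_right
    set a : A := a₁ * (a₂ * (a₃ * (a₄ * (a₅ * (a₆ * a₇))))) with hadef
    have hD1 : basicOpen a ≤ basicOpen a₁ := hl _ _
    have hD2 : basicOpen a ≤ basicOpen a₂ := (hr _ _).trans (hl _ _)
    have hD3 : basicOpen a ≤ basicOpen a₃ := ((hr _ _).trans (hr _ _)).trans (hl _ _)
    have hD4 : basicOpen a ≤ basicOpen a₄ := (((hr _ _).trans (hr _ _)).trans (hr _ _)).trans (hl _ _)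
    have hD5 : basicOpen a ≤ basicOpen a₅ :=
      ((((hr _ _).trans (hr _ _)).trans (hr _ _)).trans (hr _ _)).trans (hl _ _)
    have hD6 : basicOpen a ≤ basicOpen a₆ :=
      (((((hr _ _).trans (hr _ _)).trans (hr _ _)).trans (hr _ _)).trans (hr _ _)).trans (hl _ _)
    have hD7 : basicOpen a ≤ basicOpen a₇ :=
      (((((hr _ _).trans (hr _ _)).trans (hr _ _)).trans (hr _ _)).trans (hr _ _)).trans (hr _ _)
    have ha : a ≠ 0 := mul_ne_zero ha₁ (mul_ne_zero ha₂ (mul_ne_zero ha₃ (mul_ne_zero ha₄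
      (mul_ne_zero ha₅ (mul_ne_zero ha₆ ha₇)))))
    refine ⟨a, ha, ?_, ?_, ?_, ?_, ?_, ?_, ?_⟩
    · exact fun D hD' D' hD'' heq x hx => k₁ D hD' D' hD'' heq x (hD1 hx)
    · exact fun x hx => k₂ x (hD2 hx)
    · exact fun B T hB hT hi z hz => k₃ B T hB hT hi z (hD3 hz)
    · exact fun B T hB hT hi D₀ hD₀E hD₀B hD₀T =>
        ⟨fun z hz => (k₄ B T hB hT hi D₀ hD₀E hD₀B hD₀T).1 z (hD4 hz),
          fun z hz => (k₄ B T hB hT hi D₀ hD₀E hD₀B hD₀T).2 z (hD4 hz)⟩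
    · exact fun z hz => k₅ z (hD5 hz)
    · intro K₀ hK₀
      rcases k₆ K₀ hK₀ with ⟨p1, p2, p3⟩ | p4
      · exact Or.inl ⟨fun z hz => p1 z (hD6 hz), fun z hz => p2 z (hD6 hz), fun z hz => p3 z (hD6 hz)⟩
      · exact Or.inr fun x hx => p4 x (hD6 hx)
    · exact ModelDataAt.mono hD7 k₇

end CentreSeq

end Literature.AlgebraicGeometry.Resolution

end
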